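import Summits.NavierStokesRegularity.TurbBounds.Results.N1G2Tail
import Summits.NavierStokesRegularity.TurbBounds.RBSpectralLink
import Summits.NavierStokesRegularity.TurbBounds.RBProfileValue
import Summits.NavierStokesRegularity.TurbBounds.RBLattice
import Summits.NavierStokesRegularity.TurbBounds.SpectralFormPeriodic
import HarnessLib

/-!
# Row RB-N1 from the CITED PER-PERIOD reduction ALONE: `SpectralReductionOn (periodLattice2 2) Nu → Nu(10000) ≤ 3314014534153773665603/1074101633682631557120 ≤ 3.0853827`,
# and the per-period spectral constraint (A1) on the wavenumber lattice of the period `Γ = 2` for the certified degree-6 background, unconditional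
(cell `pub-turb` / `turb-bounds`, v2 lane; composition file — needs pub-turb-sos's staged `SpectralForm.lean` + `SpectralFormPeriodic.lean` (V2-SPEC / V2-SPEC-PERIODIC)
in the tree, gen 6's `RBSpectralLink` / `RBProfileValue` / `RBLattice` and this seat's `Results/<sub>Tail.lean` file(s). Written by pub-turb-cert, prover-pub-turb-cert-g8-0
(`code/make_spectral_lat.py N1G2 N1-canary-ra1e4-G2 N1G2`; pattern = this generation's hand-written `N1G2Spectral.lean`).)

HONEST FRAMING: rigorous bounds for the stated PDE and boundary conditions; no claim about physical turbulence beyond the bound.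
RESULT: `N1G2.spectralConstraintOn_holds : SpectralConstraintOn (periodLattice2 2) 10000 (1669897/1048576) tau'` — for the background `τ′(z) = −1 + φ(2z−1)/s`,
`φ = Σ_{p=1}^{6} φ̂_p P_p` with the CERTIFIED profile data `φ̂ = (0, -4296402867/2³⁰, 0, -345863221/2³⁰, 0, 1268642607/2³⁰)`, `s = 1669897/2²⁰`, at `Ra = 10000`, the full-gap mode form `Q_k[w, θ]` of the affine
background method is `≥ 0` on the two-sided no-slip class for EVERY wavenumber `k = 2π·m/2`, `m ≥ 1`, of the period-2 lattice — UNCONDITIONAL (8 certified blocks at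
the rational lattice data + the π-enclosure transfer + evaluator(s) + tail lemma(s) + density for `m ≤ 8`, the cutoff D1 for `m ≥ 9`, all kernel-checked; interface
`SpectralForm.spectralConstraintOn_periodLattice2_of_cutoff` of pub-turb-sos gen 13); `N1G2.nusselt_bound_of_spectralReductionOn (h : SpectralReductionOn (periodLattice2 2) Nu) :
Nu 10000 ≤ 3314014534153773665603/1074101633682631557120` (`…_decimal`: `≤ 3.0853827`) — CERTIFIED.md row RB-N1 (container `certs/N1-canary-ra1e4-G2`, rbcert.json sha256 `010df50c…`) from ONE hypothesis which is
the published reduction for a horizontally periodic box stated in mode form ([cite: DingKerswell2019, §2.1–§2.2 (13)–(16), §5.1]); `…_of_subset`: the same bound for every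
wavenumber set `L ⊆ periodLattice2 2` (`SpectralForm.spectralReductionOn_mono`; the `d = 3` boxes whose lattice lies in `(2π/2)·ℕ`); the value `s∫τ′² − (s−1) = 1 + Σ_p φ̂_p²/((2p+1)s)`
is gen 6's `RBProfile.rb_bound_value`.
NOT CLAIMED: the PDE energy argument (A1) ⇒ Nusselt bound (that IS the hypothesis); nothing about other Ra or other periods (a lattice certificate says nothing off the lattice).
-/

set_option linter.style.longLine false

noncomputable section

namespace Summit.NavierStokesRegularity.TurbBounds.Results.N1G2

open MeasureTheory intervalIntegral Finset Polynomial
open Summit.NavierStokesRegularity.TurbBounds.SpectralForm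
open Summit.NavierStokesRegularity.TurbBounds.TailTwoSided (TwoSidedX)
open Summit.NavierStokesRegularity.TurbBounds.TailPolyGenW (rbForm)
open Summit.NavierStokesRegularity.TurbBounds.RBSpectralLink (modeForm_eq_half_rbForm twoSidedX_of_twoSided)
open Summit.NavierStokesRegularity.TurbBounds.RBProfile (phiPoly tauRB tauRB_continuous tauRB_total rb_bound_value)
open Summit.NavierStokesRegularity.TurbBounds.Certs.N1G2.Evaluator (ghat1 ghat2 ghat3 ghat4 ghat5 ghat6 K_c K_c_lattice)
open Literature.Analysis.SpecialFunctions (legendre legendre_zero)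

/-- The certified Legendre shape data `φ̂_p` of the background as a real sequence (`φ̂₀ = 0`; `φ̂_p = ĝ_p` for `1 ≤ p ≤ 6`; zero beyond) — the literal `ĝ` of `Certs.N1G2.EvalData1`. -/
def phiR : ℕ → ℝ
  | 1 => ghat1 | 2 => ghat2 | 3 => ghat3 | 4 => ghat4 | 5 => ghat5 | 6 => ghat6 | _ => 0

/-- The row's background gradient `τ′(z) = −1 + φ(2z−1)/s` on `[0, 1]`, `s = 1669897/1048576`. -/
def tau' : ℝ → ℝ := tauRB ((1669897 : ℝ) / 1048576) 6 phiR

/-- The coupling profile of the certificate IS `s·τ′((y+1)/2)`: `Σ_{p≤6} ĝ_p P_p(y) = −s + φ(y)`. -/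
theorem gp_eq_profile (y : ℝ) : TailN1G2.gp.eval y = ((1669897 : ℝ) / 1048576) * tau' ((y + 1) / 2) := by
  have e : 2 * ((y + 1) / 2) - 1 = y := by ring
  unfold tau' tauRB
  rw [e]
  unfold TailN1G2.gp phiPoly
  simp only [sum_range_succ, sum_range_zero, zero_add, TailN1G2.ghatR, phiR, eval_add, eval_mul, eval_C,
    legendre_zero, eval_one]
  simp only [Certs.N1G2.Evaluator.ghat0, Certs.N1G2.Evaluator.ghat1, Certs.N1G2.Evaluator.ghat2, Certs.N1G2.Evaluator.ghat3, Certs.N1G2.Evaluator.ghat4, Certs.N1G2.Evaluator.ghat5, Certs.N1G2.Evaluator.ghat6, Certs.N1G2.Evaluator.s]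
  push_cast
  field_simp
  ring

/-- … as functions. -/
theorem gp_fun_eq_profile : (fun x : ℝ => TailN1G2.gp.eval x) = (fun y : ℝ => ((1669897 : ℝ) / 1048576) * tau' ((y + 1) / 2)) :=
  funext gp_eq_profile

/-- **(A1) on the lattice of period `Γ = 2` for row RB-N1, unconditional**: `Q_k[w, θ] ≥ 0` on the two-sided class for every `k ∈ periodLattice2 2`
(certified modes `m = 1…8` + cutoff for `m ≥ 9`, through pub-turb-sos's interface `spectralConstraintOn_periodLattice2_of_cutoff`). -/
theorem spectralConstraintOn_holds : SpectralConstraintOn (periodLattice2 (2 : ℝ)) 10000 ((1669897 : ℝ) / 1048576) tau' := by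
  have ea_0 : ((Certs.N1G2.Evaluator.a0 : ℚ) : ℝ) = (((1669897 : ℝ) / 1048576) - 1) / 10000 := by
    norm_num [Certs.N1G2.Evaluator.a0, Certs.N1G2.Evaluator.s, Certs.N1G2.Evaluator.Ra]
  have es_0 : ((Certs.N1G2.Evaluator.s : ℚ) : ℝ) = ((1669897 : ℝ) / 1048576) := by norm_num [Certs.N1G2.Evaluator.s]
  refine spectralConstraintOn_periodLattice2_of_cutoff (Kc := ((K_c : ℚ) : ℝ)) (by norm_num : (0 : ℝ) < (2 : ℝ)) 9 ?_ ?_ ?_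
  · -- the cutoff index: `K_c = K2_9 ≤ (2π·9/2)²` from `PI_LO ≤ π`
    exact sq_lattice_ge_of_pi_lower (by norm_num) (by norm_num) RBLattice.pi_lo_lt_pi.le 9 K_c_lattice
  · -- every wavenumber beyond the cutoff: D1
    intro k _hk hKc w θ hwθ
    rw [modeForm_eq_half_rbForm hwθ.hw hwθ.hθ]
    have h := TailN1G2.rbForm_nonneg_beyond_cutoff hKc (fun y => w ((y + 1) / 2)) (fun y => θ ((y + 1) / 2))
    rw [ea_0, es_0, gp_fun_eq_profile] at h
    exact mul_nonneg (by norm_num) h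
  · -- the certified lattice modes `m = 1…8`
    intro m hm hmM w θ hwθ
    rw [modeForm_eq_half_rbForm hwθ.hw hwθ.hθ]
    have h := TailN1G2.rbForm_nonneg_of_mode hm (by omega) _ _ (twoSidedX_of_twoSided hwθ)
    rw [ea_0, es_0, gp_fun_eq_profile] at h
    exact mul_nonneg (by norm_num) h

/-- The background `τ′` is an admissible profile of the cited theorem (`∫₀¹ τ′ = −1`, `τ′ ∈ L¹ ∩ L²`: it is a polynomial). -/
theorem profile_tau' : Profile tau' where
  integrable := (tauRB_continuous _ _ _).intervalIntegrable _ _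
  sq_integrable := ((tauRB_continuous _ _ _).pow 2).intervalIntegrable _ _
  total := tauRB_total _ _ (rfl : phiR 0 = 0)

/-- The value of the cited bound at this background: `s∫₀¹τ′² − (s−1) = 1 + Σ_p φ̂_p²/((2p+1)s) = 3314014534153773665603/1074101633682631557120`. -/
theorem bound_value : ((1669897 : ℝ) / 1048576) * (∫ z in (0 : ℝ)..1, tau' z ^ 2) - (((1669897 : ℝ) / 1048576) - 1)
    = (3314014534153773665603 : ℝ) / 1074101633682631557120 := by
  unfold tau'
  rw [rb_bound_value (by norm_num) 6 (rfl : phiR 0 = 0)]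
  simp only [sum_range_succ, sum_range_zero, zero_add, phiR]
  norm_num [ghat1, ghat2, ghat3, ghat4, ghat5, ghat6]

/-- **ROW RB-N1 from the cited per-period theorem alone**: for every quantity `Nu` obeying the affine background-method reduction in mode form for the
horizontally periodic box of period `Γ = 2` (`SpectralReductionOn (periodLattice2 2)`), `Nu(10000) ≤ 3314014534153773665603/1074101633682631557120`
(every Pr; d = 2 with period 2, and d = 3 boxes whose wavenumber lattice lies in `periodLattice2 2` via `…_of_subset`). -/
theorem nusselt_bound_of_spectralReductionOn (Nu : ℝ → ℝ) (h : SpectralReductionOn (periodLattice2 (2 : ℝ)) Nu) :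
    Nu 10000 ≤ (3314014534153773665603 : ℝ) / 1074101633682631557120 := by
  have hb := h 10000 ((1669897 : ℝ) / 1048576) tau' (by norm_num) (by norm_num) profile_tau' spectralConstraintOn_holds
  rw [bound_value] at hb
  exact hb

/-- Decimal form (outward rounding, as printed in CERTIFIED.md / main.md Table 1): `Nu(10000) ≤ 3.0853827` at `Γ = 2`. -/
theorem nusselt_bound_decimal_of_spectralReductionOn (Nu : ℝ → ℝ) (h : SpectralReductionOn (periodLattice2 (2 : ℝ)) Nu) :
    Nu 10000 ≤ (3.0853827 : ℝ) := by
  have hb := nusselt_bound_of_spectralReductionOn Nu h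
  have hd : (3314014534153773665603 : ℝ) / 1074101633682631557120 ≤ (3.0853827 : ℝ) := by norm_num
  linarith

/-- The same bound for every solution whose nonzero horizontal wavenumbers lie in a SUBSET of the period-2 lattice (e.g. `d = 3` boxes with
`periodLattice3 Γx Γy ⊆ periodLattice2 2`; `SpectralForm.spectralReductionOn_mono`). -/
theorem nusselt_bound_of_spectralReductionOn_of_subset {L : Set ℝ} (hL : L ⊆ periodLattice2 (2 : ℝ)) (Nu : ℝ → ℝ)
    (h : SpectralReductionOn L Nu) : Nu 10000 ≤ (3314014534153773665603 : ℝ) / 1074101633682631557120 :=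
  nusselt_bound_of_spectralReductionOn Nu (spectralReductionOn_mono hL h)

end Summit.NavierStokesRegularity.TurbBounds.Results.N1G2

end
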